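import Literature.MathematicalPhysics.QuantumManyBody.PeriodicBoseGas
import Mathlib.Analysis.Fourier.AddCircleMulti
import Mathlib.MeasureTheory.Measure.Haar.InnerProductSpace
import Mathlib.MeasureTheory.Measure.Haar.NormedSpace
import Mathlib.MeasureTheory.Integral.IntervalIntegral.FundThmCalculus
import Mathlib.Analysis.SpecialFunctions.ExpDeriv
import Mathlib.Data.Pi.Interval
import Mathlib.Data.Int.Interval
import HarnessLib

/-!
# Fourier series on the periodic cell `[0,L)³`

Topic `Literature/MathematicalPhysics/QuantumManyBody`, sibling of `PeriodicBoseGas.lean`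
(provefact `Literature.MathematicalPhysics.QuantumManyBody.BoseGas.Fournais2020_condensation`; toolkit for the proof of
[Fournais2020, Lemma 3.3], whose printed proof (pp. 16–17) expands a periodic one-body function
in the Fourier basis `e^{ikx}`, `k ∈ 2πL⁻¹ℤ³`, of `L²(Ω)`, `Ω = ℝ³/Lℤ³` ((3.19)–(3.21))).

We transport Mathlib's Fourier analysis on the unit torus `UnitAddTorus (Fin 3) = (ℝ/ℤ)³`
(`UnitAddTorus.mFourierCoeff`, the Hilbert basis `UnitAddTorus.mFourierBasis`, Parseval
`UnitAddTorus.hasSum_sq_mFourierCoeff`) to functions `φ : Space → ℂ` on `ℝ³` and the cell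
`cell L = [0,L)³` of `PeriodicBoseGas.lean`:

* `toUnitTorus L x = (x/L mod ℤ³)`, `torusFun L φ` = the function on `(ℝ/ℤ)³` whose value at
  `t` is `φ(Lx)` for the representative `x ∈ (0,1]³` of `t` (for `Lℤ³`-periodic `φ`,
  `torusFun L φ ∘ toUnitTorus L = φ`);
* `cellWave L n x = e^{2πi n·x/L}` (`= mFourier n (toUnitTorus L x)`), the plane waves of the
  torus of side `L`, and `cellFourierCoeff L φ n = L⁻³ ∫_{[0,L)³} e^{-2πi n·x/L} φ(x) dx`
  (`= mFourierCoeff (torusFun L φ) n`);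
* Parseval `∑ₙ ‖ĉₙ‖² = L⁻³ ∫_{[0,L)³} ‖φ‖²` for continuous `φ`, `ĉ₀ = L⁻³∫φ`, and for `C¹`
  periodic `φ` the derivative rule `ĉₙ(∂ⱼφ) = (2πi nⱼ/L) ĉₙ(φ)` and
  `∑ₙ (4π²|n|²/L²)‖ĉₙ‖² = L⁻³∫_{[0,L)³} |∇φ|²`.

## References

* [Fournais2020] S. Fournais, *Length scales for BEC in the dilute Bose gas*, arXiv:2011.00309,
  EMS Ser. Congr. Rep. 18 (2021): proof of Lemma 3.3, (3.19)–(3.21).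
-/

noncomputable section

open MeasureTheory Filter Set WithLp Complex
open scoped ENNReal NNReal Topology ComplexConjugate Pointwise

namespace Literature.MathematicalPhysics.QuantumManyBody.BoseGas

/-- As in `Mathlib.Analysis.Fourier.AddCircleMulti`, the measure on `ℝ/ℤ` is the Haar probability
measure (Mathlib's global instance is `ENNReal.ofReal 1 • haarAddCircle`, equal but not
definitionally; the results of that file are stated for this instance). [folklore] -/
local instance : MeasureSpace UnitAddCircle := ⟨AddCircle.haarAddCircle⟩

/-- The measure on `ℝ/ℤ` is a probability measure. [folklore] -/
local instance : IsProbabilityMeasure (volume : Measure UnitAddCircle) :=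
  inferInstanceAs (IsProbabilityMeasure AddCircle.haarAddCircle)

/-- The measure on `(ℝ/ℤ)³` is a probability measure. [folklore] -/
local instance : IsProbabilityMeasure (volume : Measure (UnitAddTorus (Fin 3))) := by
  rw [volume_pi]; infer_instance

/-! ### The cell and the unit torus -/

/-- The point `x/L mod ℤ³` of the unit torus `(ℝ/ℤ)³` under a point `x ∈ ℝ³` (the covering map of
the torus `ℝ³/Lℤ³ ≅ (ℝ/ℤ)³` of side `L`). [folklore] -/
def toUnitTorus (L : ℝ) (x : Space) : UnitAddTorus (Fin 3) :=
  fun k => ((x k / L : ℝ) : UnitAddCircle)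

/-- The representative in `L • (0,1]³ = (0,L]³` of a point of the unit torus, scaled by `L`.
[folklore] -/
def fromUnitTorus (L : ℝ) (t : UnitAddTorus (Fin 3)) : Space :=
  toLp 2 fun k => L * ((AddCircle.equivIoc 1 0 (t k) : ℝ))

/-- The function on the unit torus `(ℝ/ℤ)³` induced by a function on `ℝ³` and the side `L`:
its value at `t` is `φ(x)` for the representative `x ∈ (0,L]³` of `t`. For `Lℤ³`-periodic `φ`
this is the function on `ℝ³/Lℤ³ ≅ (ℝ/ℤ)³` that `φ` defines (`torusFun_toUnitTorus`). [folklore] -/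
def torusFun (L : ℝ) (φ : Space → ℂ) (t : UnitAddTorus (Fin 3)) : ℂ :=
  φ (fromUnitTorus L t)

/-- The plane wave `e_n(x) = e^{2πi n·x/L}` of the torus of side `L`, `n ∈ ℤ³` (the paper's
`e^{ikx}`, `k = 2πn/L ∈ 2πL⁻¹ℤ³`), as Mathlib's monomial `mFourier n` at `x/L mod ℤ³`.
[cite: Fournais2020, (3.19)] -/
def cellWave (L : ℝ) (n : Fin 3 → ℤ) (x : Space) : ℂ :=
  UnitAddTorus.mFourier n (toUnitTorus L x)

/-- The Fourier coefficient `ĉₙ(φ) = L⁻³ ∫_{[0,L)³} e^{-2πi n·x/L} φ(x) dx` of a function on the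
cell of side `L` (`cellFourierCoeff_eq_integral`), defined as Mathlib's `mFourierCoeff` of the
induced function on the unit torus. With this normalisation `φ = ∑ₙ ĉₙ e_n` and
`L⁻³∫_{[0,L)³}|φ|² = ∑ₙ |ĉₙ|²`. [folklore] -/
def cellFourierCoeff (L : ℝ) (φ : Space → ℂ) (n : Fin 3 → ℤ) : ℂ :=
  UnitAddTorus.mFourierCoeff (torusFun L φ) n

/-! ### Basic properties of the transport -/

section Transport

variable {L : ℝ}

/-- `e_n(x) = exp(2πi (∑ₖ nₖxₖ)/L)`. [folklore] -/
theorem cellWave_apply (L : ℝ) (n : Fin 3 → ℤ) (x : Space) :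
    cellWave L n x = Complex.exp (2 * Real.pi * Complex.I * (∑ k, (n k : ℝ) * x k) / L) := by
  unfold cellWave toUnitTorus UnitAddTorus.mFourier
  simp only [ContinuousMap.coe_mk, fourier_coe_apply]
  rw [← Complex.exp_sum]
  congr 1
  push_cast
  rw [mul_div_assoc, Finset.sum_div, Finset.mul_sum]
  refine Finset.sum_congr rfl fun k _ => ?_
  ring

/-- The scaled representative lies in the box `(0,L]³` (for `0 < L`). [folklore] -/
theorem fromUnitTorus_mem {L : ℝ} (hL : 0 < L) (t : UnitAddTorus (Fin 3)) (k : Fin 3) :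
    fromUnitTorus L t k ∈ Ioc 0 L := by
  have h := (AddCircle.equivIoc 1 0 (t k)).2
  simp only [zero_add, mem_Ioc] at h
  simp only [fromUnitTorus, PiLp.toLp_apply, mem_Ioc]
  constructor <;> nlinarith [h.1, h.2]

/-- On the box `(0,1]³`, `fromUnitTorus L` is multiplication by `L`. [folklore] -/
theorem fromUnitTorus_coe {L : ℝ} (x : Fin 3 → ℝ) (hx : ∀ k, x k ∈ Ioc (0 : ℝ) 1) :
    fromUnitTorus L (fun k => (x k : UnitAddCircle)) = toLp 2 (L • x) := by
  unfold fromUnitTorus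
  congr 1
  funext k
  have := AddCircle.equivIoc_coe_of_mem (p := (1 : ℝ)) (a := 0) (y := x k) (by simpa using hx k)
  rw [this, Pi.smul_apply, smul_eq_mul]

/-- Periodicity along the coordinate axes extends to the lattice `Lℤ³`. [folklore] -/
theorem periodic_latticeVec {E : Type*} {L : ℝ} {φ : Space → E}
    (hφ : ∀ (x : Space) (k : Fin 3), φ (x + EuclideanSpace.single k L) = φ x)
    (x : Space) (m : Fin 3 → ℤ) : φ (x + latticeVec L m) = φ x := by
  -- integer multiples of one axis vector
  have hax : ∀ (k : Fin 3) (j : ℤ) (y : Space), φ (y + (j : ℝ) • EuclideanSpace.single k L) = φ y := by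
    intro k
    set v : Space := EuclideanSpace.single k L
    have hbwd : ∀ y, φ (y - v) = φ y := fun y => by
      have h := hφ (y - v) k
      rw [sub_add_cancel] at h
      exact h.symm
    have hnat : ∀ (n : ℕ) (y : Space), φ (y + (n : ℝ) • v) = φ y := by
      intro n
      induction n with
      | zero => intro y; simp
      | succ n ih =>
        intro y
        have : y + ((n + 1 : ℕ) : ℝ) • v = (y + (n : ℝ) • v) + v := by
          push_cast; rw [add_smul, one_smul, add_assoc]
        rw [this, hφ, ih]
    have hnat' : ∀ (n : ℕ) (y : Space), φ (y - (n : ℝ) • v) = φ y := by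
      intro n
      induction n with
      | zero => intro y; simp
      | succ n ih =>
        intro y
        have : y - ((n + 1 : ℕ) : ℝ) • v = (y - (n : ℝ) • v) - v := by
          push_cast; rw [add_smul, one_smul, sub_add_eq_sub_sub]
        rw [this, hbwd, ih]
    intro j y
    obtain ⟨n, rfl | rfl⟩ := Int.eq_nat_or_neg j
    · exact_mod_cast hnat n y
    · have : y + ((-(n : ℤ) : ℤ) : ℝ) • v = y - (n : ℝ) • v := by
        push_cast; rw [neg_smul, sub_eq_add_neg]
      rw [this, hnat']
  -- decompose the lattice vector along the axes
  have hdec : latticeVec L m = ∑ k : Fin 3, ((m k : ℤ) : ℝ) • EuclideanSpace.single k L := by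
    ext j
    simp [latticeVec, Fin.sum_univ_three]
    fin_cases j <;> simp [mul_comm]
  rw [hdec, Fin.sum_univ_three, ← add_assoc, ← add_assoc, hax, hax, hax]

/-- The scaled representative of `x/L mod ℤ³` differs from `x` by a lattice vector. [folklore] -/
theorem exists_fromUnitTorus_toUnitTorus_eq {L : ℝ} (hL : 0 < L) (x : Space) :
    ∃ m : Fin 3 → ℤ, fromUnitTorus L (toUnitTorus L x) = x + latticeVec L m := by
  have hrep : ∀ k, ∃ m : ℤ, fromUnitTorus L (toUnitTorus L x) k = x k + L * m := by
    intro k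
    set r : ℝ := (AddCircle.equivIoc 1 0 (toUnitTorus L x k) : ℝ) with hr
    have hrx : ((r : ℝ) : UnitAddCircle) = ((x k / L : ℝ) : UnitAddCircle) := by
      rw [hr, AddCircle.coe_equivIoc]; rfl
    have h0 : ((r - x k / L : ℝ) : UnitAddCircle) = 0 := by
      rw [AddCircle.coe_sub, hrx, sub_self]
    obtain ⟨m, hm⟩ := (AddCircle.coe_eq_zero_iff (1 : ℝ)).1 h0
    refine ⟨m, ?_⟩
    simp only [fromUnitTorus, PiLp.toLp_apply]
    rw [← hr]
    have : r = x k / L + m := by rw [zsmul_eq_mul, mul_one] at hm; linarith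
    rw [this, mul_add, mul_div_cancel₀ _ hL.ne']
  choose m hm using hrep
  refine ⟨m, ?_⟩
  ext k
  rw [hm k, PiLp.add_apply, latticeVec]

/-- For an `Lℤ³`-periodic function, the induced function on the unit torus recovers `φ`:
`torusFun L φ (x/L mod ℤ³) = φ(x)`. [folklore] -/
theorem torusFun_toUnitTorus {L : ℝ} (hL : 0 < L) {φ : Space → ℂ}
    (hφ : ∀ (x : Space) (k : Fin 3), φ (x + EuclideanSpace.single k L) = φ x) (x : Space) :
    torusFun L φ (toUnitTorus L x) = φ x := by
  obtain ⟨m, hm⟩ := exists_fromUnitTorus_toUnitTorus_eq hL x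
  rw [torusFun, hm, periodic_latticeVec hφ]

/-- `x ↦ x/L mod ℤ³` maps the box `(0,1]³` representatives back: `toUnitTorus L ∘ fromUnitTorus L
= id` (for `L ≠ 0`). [folklore] -/
theorem toUnitTorus_fromUnitTorus {L : ℝ} (hL : L ≠ 0) (t : UnitAddTorus (Fin 3)) :
    toUnitTorus L (fromUnitTorus L t) = t := by
  funext k
  simp only [toUnitTorus, fromUnitTorus, PiLp.toLp_apply]
  rw [mul_div_cancel_left₀ _ hL, AddCircle.coe_equivIoc]

/-- `fromUnitTorus L` is measurable. [folklore] -/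
theorem measurable_fromUnitTorus (L : ℝ) : Measurable (fromUnitTorus L) := by
  unfold fromUnitTorus
  refine (WithLp.measurable_toLp 2 _).comp (measurable_pi_lambda _ fun k => ?_)
  refine measurable_const.mul ?_
  exact (measurable_subtype_coe.comp (AddCircle.measurableEquivIoc 1 0).measurable).comp
    (measurable_pi_apply k)

/-- The values of `fromUnitTorus L` lie in the closed box `[0,L]³` (`0 < L`). [folklore] -/
theorem fromUnitTorus_mem_closedBox {L : ℝ} (hL : 0 < L) (t : UnitAddTorus (Fin 3)) :
    fromUnitTorus L t ∈ (toLp 2 '' Set.univ.pi fun _ : Fin 3 => Icc (0 : ℝ) L : Set Space) := by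
  refine ⟨fun k => fromUnitTorus L t k, fun k _ => ?_, ?_⟩
  · have h := fromUnitTorus_mem hL t k
    exact ⟨h.1.le, h.2⟩
  · rfl

/-- The closed box `[0,L]³ ⊂ ℝ³` is compact. [folklore] -/
theorem isCompact_closedBox (L : ℝ) :
    IsCompact (toLp 2 '' Set.univ.pi fun _ : Fin 3 => Icc (0 : ℝ) L : Set Space) :=
  (isCompact_univ_pi fun _ => isCompact_Icc).image (PiLp.continuous_toLp 2 _)

/-- A continuous function is bounded on the range of `fromUnitTorus L`. [folklore] -/
theorem exists_bound_torusFun {L : ℝ} (hL : 0 < L) {E : Type*} [SeminormedAddCommGroup E]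
    {φ : Space → E} (hφ : Continuous φ) : ∃ C, ∀ t, ‖φ (fromUnitTorus L t)‖ ≤ C := by
  obtain ⟨C, hC⟩ := (isCompact_closedBox L).exists_bound_of_continuousOn hφ.continuousOn
  exact ⟨C, fun t => hC _ (fromUnitTorus_mem_closedBox hL t)⟩

/-- The induced torus function of a continuous function is in `L²` of the torus. [folklore] -/
theorem memLp_torusFun {L : ℝ} (hL : 0 < L) {φ : Space → ℂ} (hφ : Continuous φ) :
    MemLp (torusFun L φ) 2 volume := by
  obtain ⟨C, hC⟩ := exists_bound_torusFun hL hφ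
  exact MemLp.of_bound ((hφ.measurable.comp (measurable_fromUnitTorus L)).aestronglyMeasurable) C
    (Eventually.of_forall hC)

/-- The box `(0,L]³` and the cell `[0,L)³` agree up to a null set. [folklore] -/
theorem boxIoc_ae_eq_cell (L : ℝ) : ({x : Space | ∀ k, x k ∈ Ioc 0 L}) =ᵐ[volume] cell L := by
  have h1 : {x : Space | ∀ k, x k ∈ Ioc 0 L} = (@ofLp 2 (Fin 3 → ℝ)) ⁻¹' (Set.univ.pi fun _ => Ioc 0 L) := by
    ext x; simp
  have h2 : cell L = (@ofLp 2 (Fin 3 → ℝ)) ⁻¹' (Set.univ.pi fun _ => Ico 0 L) := by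
    ext x; simp [cell]
  rw [h1, h2]
  refine (PiLp.volume_preserving_ofLp (Fin 3)).quasiMeasurePreserving.preimage_ae_eq ?_
  rw [volume_pi]
  exact Measure.univ_pi_Ioc_ae_eq_Icc.trans Measure.univ_pi_Ico_ae_eq_Icc.symm

/-- Scaling of Lebesgue integrals on `ℝ³`: `∫ H(Lb) db = L⁻³ ∫ H`. [folklore] -/
theorem lintegral_comp_smul {L : ℝ} (hL : 0 < L) {H : Space → ℝ≥0∞} (hH : Measurable H) :
    ∫⁻ b, H (L • b) = (ENNReal.ofReal L ^ 3)⁻¹ * ∫⁻ z, H z := by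
  rw [← lintegral_map hH (measurable_const_smul L), Measure.map_addHaar_smul volume hL.ne',
    lintegral_smul_measure, finrank_euclideanSpace_fin, abs_of_pos (by positivity), smul_eq_mul,
    ENNReal.ofReal_inv_of_pos (by positivity), ENNReal.ofReal_pow hL.le]

/-- `L • (0,1]³ = (0,L]³`. [folklore] -/
theorem smul_boxIoc_one {L : ℝ} (hL : 0 < L) :
    L • ({y : Space | ∀ k, y k ∈ Ioc (0 : ℝ) 1}) = {z : Space | ∀ k, z k ∈ Ioc 0 L} := by
  ext z
  rw [Set.mem_smul_set_iff_inv_smul_mem₀ hL.ne']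
  simp only [mem_setOf_eq, PiLp.smul_apply, smul_eq_mul, mem_Ioc]
  refine forall_congr' fun k => ?_
  rw [inv_mul_eq_div, lt_div_iff₀ hL, div_le_one hL, zero_mul]

/-- The boxes `{y | ∀ k, y k ∈ (a,b]}` are measurable. [folklore] -/
theorem measurableSet_boxIoc (a b : ℝ) : MeasurableSet {y : Space | ∀ k, y k ∈ Ioc a b} := by
  have : {y : Space | ∀ k, y k ∈ Ioc a b} = ⋂ k : Fin 3, (fun y : Space => y k) ⁻¹' Ioc a b := by
    ext y; simp
  rw [this]
  exact MeasurableSet.iInter fun k => measurableSet_Ioc.preimage (by fun_prop)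

/-- **Integration over the torus in the cell picture** (`ℝ≥0∞` version):
`∫_{(ℝ/ℤ)³} G(fromUnitTorus L t) dt = L⁻³ ∫_{[0,L)³} G`. [folklore] -/
theorem lintegral_fromUnitTorus {L : ℝ} (hL : 0 < L) {G : Space → ℝ≥0∞} (hG : Measurable G) :
    ∫⁻ t, G (fromUnitTorus L t) = (ENNReal.ofReal L ^ 3)⁻¹ * ∫⁻ x in cell L, G x := by
  rw [UnitAddTorus.lintegral_preimage (fun t => G (fromUnitTorus L t)) 0]
  have hB : {x : Fin 3 → ℝ | ∀ i, x i ∈ Ioc ((0 : Fin 3 → ℝ) i) ((0 : Fin 3 → ℝ) i + 1)} =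
      (toLp 2) ⁻¹' {y : Space | ∀ k, y k ∈ Ioc (0 : ℝ) 1} := by
    ext x; simp
  have hS : MeasurableSet {y : Space | ∀ k, y k ∈ Ioc (0 : ℝ) 1} := measurableSet_boxIoc 0 1
  rw [hB]
  have hcongr : ∀ x ∈ (toLp 2) ⁻¹' {y : Space | ∀ k, y k ∈ Ioc (0 : ℝ) 1},
      G (fromUnitTorus L (fun i => (x i : UnitAddCircle))) = (fun y : Space => G (L • y)) (toLp 2 x) := by
    intro x hx
    simp only [Set.mem_preimage, mem_setOf_eq] at hx
    simp only [fromUnitTorus_coe x hx, WithLp.toLp_smul]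
  rw [setLIntegral_congr_fun (hS.preimage (WithLp.measurable_toLp 2 _)) hcongr,
    (PiLp.volume_preserving_toLp (Fin 3)).setLIntegral_comp_preimage hS
      (f := fun y : Space => G (L • y)) (hG.comp (measurable_const_smul L))]
  -- scaling
  have hLS : MeasurableSet {z : Space | ∀ k, z k ∈ Ioc 0 L} := measurableSet_boxIoc 0 L
  have hind : ∀ b : Space, ({y : Space | ∀ k, y k ∈ Ioc (0 : ℝ) 1}).indicator (fun y => G (L • y)) b =
      ({z : Space | ∀ k, z k ∈ Ioc 0 L}).indicator G (L • b) := by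
    intro b
    rw [← smul_boxIoc_one hL]
    by_cases hb : b ∈ {y : Space | ∀ k, y k ∈ Ioc (0 : ℝ) 1}
    · rw [indicator_of_mem hb, indicator_of_mem (Set.smul_mem_smul_set hb)]
    · rw [indicator_of_notMem hb, indicator_of_notMem]
      rwa [Set.smul_mem_smul_set_iff₀ hL.ne']
  rw [← lintegral_indicator hS, funext hind, lintegral_comp_smul hL (hG.indicator hLS),
    lintegral_indicator hLS, setLIntegral_congr (boxIoc_ae_eq_cell L)]

/-- **Integration over the torus in the cell picture** (Bochner version):
`∫_{(ℝ/ℤ)³} G(fromUnitTorus L t) dt = L⁻³ ∫_{[0,L)³} G`. [folklore] -/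
theorem integral_fromUnitTorus {L : ℝ} (hL : 0 < L) {E : Type*} [NormedAddCommGroup E]
    [NormedSpace ℝ E] (G : Space → E) :
    ∫ t, G (fromUnitTorus L t) = ((L ^ 3)⁻¹ : ℝ) • ∫ x in cell L, G x := by
  rw [UnitAddTorus.integral_preimage (fun t => G (fromUnitTorus L t)) 0]
  have hB : {x : Fin 3 → ℝ | ∀ i, x i ∈ Ioc ((0 : Fin 3 → ℝ) i) ((0 : Fin 3 → ℝ) i + 1)} =
      (toLp 2) ⁻¹' {y : Space | ∀ k, y k ∈ Ioc (0 : ℝ) 1} := by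
    ext x; simp
  have hS : MeasurableSet {y : Space | ∀ k, y k ∈ Ioc (0 : ℝ) 1} := measurableSet_boxIoc 0 1
  rw [hB]
  have hcongr : ∀ x ∈ (toLp 2) ⁻¹' {y : Space | ∀ k, y k ∈ Ioc (0 : ℝ) 1},
      G (fromUnitTorus L (fun i => (x i : UnitAddCircle))) = (fun y : Space => G (L • y)) (toLp 2 x) := by
    intro x hx
    simp only [Set.mem_preimage, mem_setOf_eq] at hx
    simp only [fromUnitTorus_coe x hx, WithLp.toLp_smul]
  rw [setIntegral_congr_fun (hS.preimage (WithLp.measurable_toLp 2 _)) hcongr,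
    (PiLp.volume_preserving_toLp (Fin 3)).setIntegral_preimage_emb
      (MeasurableEquiv.toLp 2 (Fin 3 → ℝ)).measurableEmbedding (fun y : Space => G (L • y)) _,
    Measure.setIntegral_comp_smul_of_pos volume G _ hL, smul_boxIoc_one hL,
    finrank_euclideanSpace_fin, setIntegral_congr_set (boxIoc_ae_eq_cell L)]

/-- **The Fourier coefficients as cell integrals**:
`ĉₙ(φ) = L⁻³ ∫_{[0,L)³} conj(e_n(x)) φ(x) dx = L⁻³ ∫_{[0,L)³} e^{-2πi n·x/L} φ(x) dx`.
[folklore] -/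
theorem cellFourierCoeff_eq_integral {L : ℝ} (hL : 0 < L) (φ : Space → ℂ) (n : Fin 3 → ℤ) :
    cellFourierCoeff L φ n = ((L ^ 3)⁻¹ : ℝ) • ∫ x in cell L, conj (cellWave L n x) * φ x := by
  unfold cellFourierCoeff UnitAddTorus.mFourierCoeff
  have h : ∀ t : UnitAddTorus (Fin 3), UnitAddTorus.mFourier (-n) t • torusFun L φ t =
      (fun x : Space => conj (cellWave L n x) * φ x) (fromUnitTorus L t) := by
    intro t
    simp only [torusFun, cellWave, smul_eq_mul, toUnitTorus_fromUnitTorus hL.ne',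
      UnitAddTorus.mFourier_neg]
  simp_rw [h]
  exact integral_fromUnitTorus hL (fun x : Space => conj (cellWave L n x) * φ x)

/-- `e_0 = 1`. [folklore] -/
theorem cellWave_zero (L : ℝ) (x : Space) : cellWave L 0 x = 1 := by
  simp [cellWave, UnitAddTorus.mFourier_zero]

/-- `|e_n(x)| = 1`. [folklore] -/
theorem norm_cellWave (L : ℝ) (n : Fin 3 → ℤ) (x : Space) : ‖cellWave L n x‖ = 1 := by
  rw [cellWave_apply, Complex.norm_exp]
  have : (2 * Real.pi * Complex.I * ((∑ k, (n k : ℝ) * x k : ℝ) : ℂ) / (L : ℂ)) =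
      ((2 * Real.pi * (∑ k, (n k : ℝ) * x k) / L : ℝ) : ℂ) * Complex.I := by push_cast; ring
  rw [this, Complex.re_ofReal_mul, Complex.I_re, mul_zero, Real.exp_zero]

/-- **The zeroth coefficient is the mean**: `ĉ₀(φ) = L⁻³ ∫_{[0,L)³} φ`. [folklore] -/
theorem cellFourierCoeff_zero {L : ℝ} (hL : 0 < L) (φ : Space → ℂ) :
    cellFourierCoeff L φ 0 = ((L ^ 3)⁻¹ : ℝ) • ∫ x in cell L, φ x := by
  rw [cellFourierCoeff_eq_integral hL]
  simp [cellWave_zero]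

/-- **Parseval on the cell.** For continuous `φ`, `∑ₙ ‖ĉₙ(φ)‖² = L⁻³ ∫_{[0,L)³} ‖φ‖²` (as a
`HasSum`; Mathlib's Parseval identity for `L²((ℝ/ℤ)³)` transported). [folklore] -/
theorem hasSum_sq_cellFourierCoeff {L : ℝ} (hL : 0 < L) {φ : Space → ℂ} (hφ : Continuous φ) :
    HasSum (fun n => ‖cellFourierCoeff L φ n‖ ^ 2) ((L ^ 3)⁻¹ * ∫ x in cell L, ‖φ x‖ ^ 2) := by
  have hf := memLp_torusFun hL hφ
  have hP := UnitAddTorus.hasSum_sq_mFourierCoeff (hf.toLp _)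
  have hcoeff : ∀ n, UnitAddTorus.mFourierCoeff (hf.toLp _ : UnitAddTorus (Fin 3) → ℂ) n =
      cellFourierCoeff L φ n := fun n =>
    integral_congr_ae (hf.coeFn_toLp.mono fun t ht => by simp only [ht])
  have hnorm : ∫ t, ‖(hf.toLp _ : UnitAddTorus (Fin 3) → ℂ) t‖ ^ 2 = ∫ t, ‖torusFun L φ t‖ ^ 2 :=
    integral_congr_ae (hf.coeFn_toLp.mono fun t ht => by simp only [ht])
  simp only [hcoeff, hnorm] at hP
  have htr := integral_fromUnitTorus hL (fun x : Space => ‖φ x‖ ^ 2)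
  simp only [smul_eq_mul] at htr
  unfold torusFun at hP
  rwa [htr] at hP

/-- The cell is contained in the closed box `[0,L]³`. [folklore] -/
theorem cell_subset_closedBox (L : ℝ) :
    cell L ⊆ (toLp 2 '' Set.univ.pi fun _ : Fin 3 => Icc (0 : ℝ) L : Set Space) := fun x hx =>
  ⟨ofLp x, fun k _ => ⟨(hx k).1, (hx k).2.le⟩, rfl⟩

/-- A continuous function is square integrable on the cell. [folklore] -/
theorem integrableOn_sq_cell (L : ℝ) {φ : Space → ℂ} (hφ : Continuous φ) :
    IntegrableOn (fun x : Space => ‖φ x‖ ^ 2) (cell L) volume :=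
  ((hφ.norm.pow 2).continuousOn.integrableOn_compact (isCompact_closedBox L)).mono_set
    (cell_subset_closedBox L)

/-- `(‖z‖₊)² = ofReal (‖z‖²)` in `ℝ≥0∞`. [folklore] -/
theorem coe_nnnorm_sq_eq_ofReal {E : Type*} [SeminormedAddCommGroup E] (z : E) :
    ((‖z‖₊ : ℝ≥0∞) ^ 2) = ENNReal.ofReal (‖z‖ ^ 2) := by
  rw [ENNReal.ofReal_pow (norm_nonneg _), ofReal_norm, enorm_eq_nnnorm]

/-- Parseval on the cell, `ℝ≥0∞` form: `∑ₙ ‖ĉₙ(φ)‖₊² = L⁻³ ∫⁻_{[0,L)³} ‖φ‖₊²`. [folklore] -/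
theorem tsum_sq_cellFourierCoeff {L : ℝ} (hL : 0 < L) {φ : Space → ℂ} (hφ : Continuous φ) :
    ∑' n, (‖cellFourierCoeff L φ n‖₊ : ℝ≥0∞) ^ 2 =
      (ENNReal.ofReal L ^ 3)⁻¹ * ∫⁻ x in cell L, (‖φ x‖₊ : ℝ≥0∞) ^ 2 := by
  have h := hasSum_sq_cellFourierCoeff hL hφ
  have hint := integrableOn_sq_cell L hφ
  simp only [coe_nnnorm_sq_eq_ofReal]
  rw [← ENNReal.ofReal_tsum_of_nonneg (fun n => by positivity) h.summable, h.tsum_eq,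
    ENNReal.ofReal_mul (by positivity), ← ENNReal.ofReal_pow hL.le,
    ENNReal.ofReal_inv_of_pos (by positivity),
    ofReal_integral_eq_lintegral_ofReal hint (Eventually.of_forall fun x => by positivity)]

end Transport

/-! ### Integration by parts on the cell and the derivative rule -/

section Derivative

variable {L : ℝ}

/-- `insertNth j t x' = insertNth j 0 x' + t e_j` in `ℝ³`. [folklore] -/
theorem insertNth_eq_add_single (j : Fin 3) (t : ℝ) (x' : Fin 2 → ℝ) :
    (Fin.insertNth (α := fun _ => ℝ) j t x' : Fin 3 → ℝ) =
      (Fin.insertNth (α := fun _ => ℝ) j 0 x' : Fin 3 → ℝ) + Pi.single j t := by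
  ext k
  rcases Fin.eq_self_or_eq_succAbove j k with rfl | ⟨i, rfl⟩
  · simp
  · simp [Fin.insertNth_apply_succAbove, Fin.succAbove_ne]

/-- The derivative of a differentiable `ψ` along the line `t ↦ a + t e_j` is `∂ⱼψ`. [folklore] -/
theorem hasDerivAt_lineSlice {ψ : Space → ℂ} (hψ : Differentiable ℝ ψ) (a : Space) (j : Fin 3)
    (t : ℝ) :
    HasDerivAt (fun s : ℝ => ψ (a + s • EuclideanSpace.single j (1 : ℝ)))
      (fderiv ℝ ψ (a + t • EuclideanSpace.single j 1) (EuclideanSpace.single j 1)) t := by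
  have hline : HasDerivAt (fun s : ℝ => a + s • EuclideanSpace.single j (1 : ℝ))
      (EuclideanSpace.single j (1 : ℝ)) t := by
    simpa using ((hasDerivAt_id t).smul_const (EuclideanSpace.single j (1 : ℝ))).const_add a
  exact (hψ _).hasFDerivAt.comp_hasDerivAt t hline

/-- **Periodic integration by parts, boundary form**: the cell integral of a partial derivative
of a `C¹` `Lℤ³`-periodic function vanishes, `∫_{[0,L)³} ∂ⱼψ = 0` (Fubini in the `j`-th coordinate
and the fundamental theorem of calculus; the boundary terms cancel by periodicity). [folklore] -/
theorem integral_cell_fderiv_eq_zero (hL : 0 < L) {ψ : Space → ℂ} (hψ : ContDiff ℝ 1 ψ)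
    (hper : ∀ (x : Space) (k : Fin 3), ψ (x + EuclideanSpace.single k L) = ψ x) (j : Fin 3) :
    ∫ x in cell L, fderiv ℝ ψ x (EuclideanSpace.single j 1) = 0 := by
  set F : Space → ℂ := fun x => fderiv ℝ ψ x (EuclideanSpace.single j 1) with hFdef
  have hFc : Continuous F := (hψ.continuous_fderiv one_ne_zero).clm_apply continuous_const
  have hdiff : Differentiable ℝ ψ := hψ.differentiable one_ne_zero
  -- (a) to `Fin 3 → ℝ`
  have hcell : (toLp 2) ⁻¹' cell L = {y : Fin 3 → ℝ | ∀ k, y k ∈ Ico 0 L} := by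
    ext y; simp [cell]
  have h1 : ∫ x in cell L, F x = ∫ y in {y : Fin 3 → ℝ | ∀ k, y k ∈ Ico 0 L}, F (toLp 2 y) := by
    rw [← hcell]
    exact ((PiLp.volume_preserving_toLp (Fin 3)).setIntegral_preimage_emb
      (MeasurableEquiv.toLp 2 (Fin 3 → ℝ)).measurableEmbedding F (cell L)).symm
  rw [h1]
  -- (b) split off the `j`-th coordinate
  set e := MeasurableEquiv.piFinSuccAbove (fun _ : Fin 3 => ℝ) j with he
  have hmp : MeasurePreserving e.symm (volume.prod volume) volume :=
    (volume_preserving_piFinSuccAbove (fun _ : Fin 3 => ℝ) j).symm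
  have hesymm : ∀ z : ℝ × (Fin 2 → ℝ), e.symm z = Fin.insertNth (α := fun _ => ℝ) j z.1 z.2 := by
    intro z
    rw [he, MeasurableEquiv.piFinSuccAbove_symm_apply]
    funext k
    exact Fin.insertNthEquiv_apply _ _ _ _
  have hpre : e.symm ⁻¹' {y : Fin 3 → ℝ | ∀ k, y k ∈ Ico 0 L} =
      Ico (0 : ℝ) L ×ˢ (Set.univ.pi fun _ : Fin 2 => Ico (0 : ℝ) L) := by
    ext ⟨t, x'⟩
    simp only [Set.mem_preimage, mem_setOf_eq, hesymm, Set.mem_prod, Set.mem_univ_pi]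
    rw [Fin.forall_iff_succAbove j]
    simp [Fin.insertNth_apply_same, Fin.insertNth_apply_succAbove]
  have h2 : ∫ y in {y : Fin 3 → ℝ | ∀ k, y k ∈ Ico 0 L}, F (toLp 2 y) =
      ∫ z in Ico (0 : ℝ) L ×ˢ (Set.univ.pi fun _ : Fin 2 => Ico (0 : ℝ) L),
        F (toLp 2 (Fin.insertNth (α := fun _ => ℝ) j z.1 z.2)) ∂(volume.prod volume) := by
    rw [← hpre, ← hmp.setIntegral_preimage_emb e.symm.measurableEmbedding (fun y => F (toLp 2 y))]
    simp only [hesymm]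
  rw [h2, ← Measure.prod_restrict]
  -- (c) Fubini, integrating first over the `j`-th coordinate
  set G : ℝ × (Fin 2 → ℝ) → ℂ := fun z => F (toLp 2 (Fin.insertNth (α := fun _ => ℝ) j z.1 z.2))
    with hGdef
  have hGm : Measurable G := by
    refine hFc.measurable.comp ((WithLp.measurable_toLp 2 _).comp ?_)
    have : (fun z : ℝ × (Fin 2 → ℝ) => (Fin.insertNth (α := fun _ => ℝ) j z.1 z.2 : Fin 3 → ℝ)) = e.symm :=
      funext fun z => (hesymm z).symm
    rw [this]
    exact e.symm.measurable
  obtain ⟨C, hC⟩ := (isCompact_closedBox L).exists_bound_of_continuousOn hFc.continuousOn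
  have hGint : Integrable G ((volume.restrict (Ico (0 : ℝ) L)).prod
      (volume.restrict (Set.univ.pi fun _ : Fin 2 => Ico (0 : ℝ) L))) := by
    rw [Measure.prod_restrict]
    refine Measure.integrableOn_of_bounded (M := C) ?_ hGm.aestronglyMeasurable ?_
    · rw [Measure.prod_prod]
      exact ENNReal.mul_ne_top measure_Ico_lt_top.ne
        (by rw [volume_pi_pi]; simp [Real.volume_Ico])
    · refine (ae_restrict_iff' (measurableSet_Ico.prod
        (MeasurableSet.univ_pi fun _ => measurableSet_Ico))).2 (Eventually.of_forall ?_)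
      rintro ⟨t, x'⟩ ⟨ht, hx'⟩
      refine hC _ ⟨Fin.insertNth (α := fun _ => ℝ) j t x', fun k _ => ?_, rfl⟩
      rcases Fin.eq_self_or_eq_succAbove j k with rfl | ⟨i, rfl⟩
      · rw [Fin.insertNth_apply_same]; exact ⟨ht.1, ht.2.le⟩
      · rw [Fin.insertNth_apply_succAbove]
        have := (Set.mem_univ_pi.1 hx') i
        exact ⟨this.1, this.2.le⟩
  rw [integral_prod_symm G hGint]
  -- (d) the inner integral vanishes
  refine integral_eq_zero_of_ae (Eventually.of_forall fun x' => ?_)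
  set a : Space := toLp 2 (Fin.insertNth (α := fun _ => ℝ) j 0 x') with ha
  have hline : ∀ t : ℝ, toLp 2 (Fin.insertNth (α := fun _ => ℝ) j t x') =
      a + t • EuclideanSpace.single j (1 : ℝ) := by
    intro t
    rw [insertNth_eq_add_single, WithLp.toLp_add, ha, PiLp.toLp_single]
    congr 1
    ext k
    simp [PiLp.single_apply]
  show ∫ t in Ico (0 : ℝ) L, G (t, x') = 0
  simp only [hGdef, hline]
  rw [integral_Ico_eq_integral_Ioc, ← intervalIntegral.integral_of_le hL.le,
    intervalIntegral.integral_eq_sub_of_hasDerivAt (f := fun s : ℝ => ψ (a + s • EuclideanSpace.single j (1 : ℝ)))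
      (fun t _ => hasDerivAt_lineSlice hdiff a j t)
      ((hFc.comp (continuous_const.add (continuous_id.smul continuous_const))).intervalIntegrable 0 L)]
  have hLv : a + L • EuclideanSpace.single j (1 : ℝ) = a + EuclideanSpace.single j L := by
    congr 1
    ext k
    simp [PiLp.single_apply]
  rw [hLv, hper, zero_smul, add_zero, sub_self]

/-- The exponent of the plane waves is a continuous `ℝ`-linear form:
`(∑ₖ nₖ yₖ : ℂ) = (ofRealCLM ∘ ∑ₖ nₖ projₖ) y`. [folklore] -/
theorem sum_coord_eq_clm (n : Fin 3 → ℤ) (y : Space) :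
    ((∑ k, (n k : ℝ) * y k : ℝ) : ℂ) =
      (Complex.ofRealCLM.comp (∑ k : Fin 3, (n k : ℝ) • PiLp.proj (𝕜 := ℝ) 2 (fun _ : Fin 3 => ℝ) k)) y := by
  simp

/-- The plane wave as the exponential of a continuous linear form. [folklore] -/
theorem cellWave_eq_exp_clm (L : ℝ) (n : Fin 3 → ℤ) :
    cellWave L n = fun y : Space => Complex.exp ((2 * Real.pi * Complex.I / L) *
      (Complex.ofRealCLM.comp (∑ k : Fin 3, (n k : ℝ) • PiLp.proj (𝕜 := ℝ) 2 (fun _ : Fin 3 => ℝ) k)) y) := by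
  funext y
  rw [cellWave_apply, ← sum_coord_eq_clm]
  congr 1
  ring

/-- The plane waves are smooth. [folklore] -/
theorem contDiff_cellWave (L : ℝ) (n : Fin 3 → ℤ) : ContDiff ℝ (⊤ : ℕ∞) (cellWave L n) := by
  rw [cellWave_eq_exp_clm]
  exact Complex.contDiff_exp.comp (contDiff_const.mul (ContinuousLinearMap.contDiff _))

/-- **Derivative of the plane waves**: `De_n(x) = e_n(x) (2πi/L) (∑ₖ nₖ projₖ)`. [folklore] -/
theorem hasFDerivAt_cellWave (L : ℝ) (n : Fin 3 → ℤ) (x : Space) :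
    HasFDerivAt (cellWave L n)
      (cellWave L n x • ((2 * Real.pi * Complex.I / L) •
        (Complex.ofRealCLM.comp (∑ k : Fin 3, (n k : ℝ) • PiLp.proj (𝕜 := ℝ) 2 (fun _ : Fin 3 => ℝ) k)))) x := by
  have h := ((ContinuousLinearMap.hasFDerivAt (Complex.ofRealCLM.comp
    (∑ k : Fin 3, (n k : ℝ) • PiLp.proj (𝕜 := ℝ) 2 (fun _ : Fin 3 => ℝ) k)) (x := x)).const_mul
    (2 * Real.pi * Complex.I / L)).cexp
  rw [cellWave_eq_exp_clm]
  exact h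

/-- `∂ⱼ e_n(x) = (2πi nⱼ / L) e_n(x)`. [folklore] -/
theorem fderiv_cellWave_apply_single (L : ℝ) (n : Fin 3 → ℤ) (x : Space) (j : Fin 3) :
    fderiv ℝ (cellWave L n) x (EuclideanSpace.single j 1) =
      (2 * Real.pi * Complex.I * (n j) / L) * cellWave L n x := by
  rw [(hasFDerivAt_cellWave L n x).fderiv, smul_apply,
    smul_apply, ← sum_coord_eq_clm]
  have : (∑ k : Fin 3, (n k : ℝ) * (EuclideanSpace.single j (1 : ℝ) : Space) k) = n j := by
    simp [PiLp.single_apply, Finset.sum_ite_eq']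
  rw [this, smul_eq_mul, smul_eq_mul]
  push_cast
  ring

/-- The plane waves are `Lℤ³`-periodic. [folklore] -/
theorem cellWave_periodic {L : ℝ} (hL : L ≠ 0) (n : Fin 3 → ℤ) (x : Space) (k : Fin 3) :
    cellWave L n (x + EuclideanSpace.single k L) = cellWave L n x := by
  unfold cellWave
  congr 1
  funext i
  simp only [toUnitTorus, PiLp.add_apply]
  by_cases hi : i = k
  · subst hi
    rw [show (EuclideanSpace.single i L : Space) i = L by simp, add_div,
      div_self hL, AddCircle.coe_add_period]
  · rw [show (EuclideanSpace.single k L : Space) i = 0 by simp [hi], add_zero]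

/-- `conj(e_n) = e_{-n}`. [folklore] -/
theorem conj_cellWave (L : ℝ) (n : Fin 3 → ℤ) (x : Space) :
    conj (cellWave L n x) = cellWave L (-n) x := by
  unfold cellWave
  rw [UnitAddTorus.mFourier_neg]

/-- A continuous function is integrable on the cell. [folklore] -/
theorem integrableOn_cell {L : ℝ} {E : Type*} [NormedAddCommGroup E] {f : Space → E}
    (hf : Continuous f) : IntegrableOn f (cell L) volume :=
  (hf.continuousOn.integrableOn_compact (isCompact_closedBox L)).mono_set (cell_subset_closedBox L)

/-- **The derivative rule** `ĉₙ(∂ⱼφ) = (2πi nⱼ / L) ĉₙ(φ)` for a `C¹` `Lℤ³`-periodic function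
(integration by parts on the torus, no boundary terms). [folklore] -/
theorem cellFourierCoeff_fderiv {L : ℝ} (hL : 0 < L) {φ : Space → ℂ} (hφ : ContDiff ℝ 1 φ)
    (hper : ∀ (x : Space) (k : Fin 3), φ (x + EuclideanSpace.single k L) = φ x) (j : Fin 3)
    (n : Fin 3 → ℤ) :
    cellFourierCoeff L (fun x => fderiv ℝ φ x (EuclideanSpace.single j 1)) n =
      (2 * Real.pi * Complex.I * (n j) / L) * cellFourierCoeff L φ n := by
  -- integration by parts applied to `ψ = e_{-n} φ`
  set ψ : Space → ℂ := fun x => cellWave L (-n) x * φ x with hψdef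
  have hψC : ContDiff ℝ 1 ψ := ((contDiff_cellWave L (-n)).of_le (mod_cast le_top)).mul hφ
  have hψper : ∀ (x : Space) (k : Fin 3), ψ (x + EuclideanSpace.single k L) = ψ x := by
    intro x k
    simp only [hψdef, cellWave_periodic hL.ne', hper]
  have hIBP := integral_cell_fderiv_eq_zero hL hψC hψper j
  -- product rule
  have hprod : ∀ x : Space, fderiv ℝ ψ x (EuclideanSpace.single j 1) =
      cellWave L (-n) x * fderiv ℝ φ x (EuclideanSpace.single j 1) +
        (2 * Real.pi * Complex.I * ((-n) j) / L) * cellWave L (-n) x * φ x := by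
    intro x
    have hw : DifferentiableAt ℝ (cellWave L (-n)) x :=
      ((contDiff_cellWave L (-n)).differentiable (by simp)) x
    have h := hw.hasFDerivAt.mul ((hφ.differentiable one_ne_zero) x).hasFDerivAt
    rw [show ψ = (cellWave L (-n)) * φ from rfl, h.fderiv, add_apply,
      smul_apply, smul_apply, fderiv_cellWave_apply_single,
      smul_eq_mul, smul_eq_mul]
    ring
  simp only [hprod] at hIBP
  have hi1 : IntegrableOn (fun x => cellWave L (-n) x * fderiv ℝ φ x (EuclideanSpace.single j 1))
      (cell L) volume :=
    integrableOn_cell ((contDiff_cellWave L (-n)).continuous.mul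
      ((hφ.continuous_fderiv one_ne_zero).clm_apply continuous_const))
  have hi2 : IntegrableOn (fun x => (2 * Real.pi * Complex.I * ((-n) j) / L) * cellWave L (-n) x * φ x)
      (cell L) volume := by
    have := integrableOn_cell (L := L) (((contDiff_cellWave L (-n)).continuous.mul hφ.continuous).const_mul
      (2 * Real.pi * Complex.I * ((-n) j) / L))
    refine this.congr_fun (fun x _ => ?_) (measurableSet_cell L)
    simp only [Pi.mul_apply]; ring
  rw [integral_add hi1 hi2] at hIBP
  have hi2' : ∫ x in cell L, (2 * Real.pi * Complex.I * ((-n) j) / L) * cellWave L (-n) x * φ x =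
      (2 * Real.pi * Complex.I * ((-n) j) / L) * ∫ x in cell L, cellWave L (-n) x * φ x := by
    rw [← integral_const_mul]
    congr 1; funext x; ring
  rw [hi2'] at hIBP
  rw [cellFourierCoeff_eq_integral hL, cellFourierCoeff_eq_integral hL]
  simp only [conj_cellWave]
  rw [Complex.real_smul, Complex.real_smul]
  have key : ∫ x in cell L, cellWave L (-n) x * fderiv ℝ φ x (EuclideanSpace.single j 1) =
      (2 * Real.pi * Complex.I * (n j) / L) * ∫ x in cell L, cellWave L (-n) x * φ x := by
    have h := eq_neg_of_add_eq_zero_left hIBP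
    rw [h]
    simp only [Pi.neg_apply, Int.cast_neg]
    ring
  rw [key]
  ring

/-- `‖ĉₙ(∂ⱼφ)‖₊² = (4π² nⱼ²/L²) ‖ĉₙ(φ)‖₊²`. [folklore] -/
theorem nnnorm_sq_cellFourierCoeff_fderiv {L : ℝ} (hL : 0 < L) {φ : Space → ℂ}
    (hφ : ContDiff ℝ 1 φ) (hper : ∀ (x : Space) (k : Fin 3), φ (x + EuclideanSpace.single k L) = φ x)
    (j : Fin 3) (n : Fin 3 → ℤ) :
    ((‖cellFourierCoeff L (fun x => fderiv ℝ φ x (EuclideanSpace.single j 1)) n‖₊ : ℝ≥0∞) ^ 2) =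
      ENNReal.ofReal (4 * Real.pi ^ 2 * (n j : ℝ) ^ 2 / L ^ 2) *
        (‖cellFourierCoeff L φ n‖₊ : ℝ≥0∞) ^ 2 := by
  rw [cellFourierCoeff_fderiv hL hφ hper, coe_nnnorm_sq_eq_ofReal, coe_nnnorm_sq_eq_ofReal,
    ← ENNReal.ofReal_mul (by positivity), norm_mul, mul_pow]
  congr 1
  have h : ‖(2 * Real.pi * Complex.I * (n j) / L : ℂ)‖ = 2 * Real.pi * |(n j : ℝ)| / L := by
    rw [show (2 * Real.pi * Complex.I * (n j) / L : ℂ) = ((2 * Real.pi * (n j : ℝ) / L : ℝ) : ℂ) * Complex.I by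
      push_cast; ring]
    rw [norm_mul, Complex.norm_I, mul_one, Complex.norm_real, Real.norm_eq_abs, abs_div, abs_mul,
      abs_of_pos (by positivity : (0 : ℝ) < 2 * Real.pi), abs_of_pos hL]
  rw [h]
  field_simp
  rw [sq_abs]
  ring

/-- **Parseval for the gradient**: for a `C¹` `Lℤ³`-periodic function,
`∑ₙ (4π²|n|²/L²) ‖ĉₙ(φ)‖₊² = L⁻³ ∫⁻_{[0,L)³} |∇φ|²`, `|∇φ|² = ∑ⱼ |∂ⱼφ|²`. [folklore] -/
theorem tsum_sq_grad_cellFourierCoeff {L : ℝ} (hL : 0 < L) {φ : Space → ℂ} (hφ : ContDiff ℝ 1 φ)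
    (hper : ∀ (x : Space) (k : Fin 3), φ (x + EuclideanSpace.single k L) = φ x) :
    ∑' n : Fin 3 → ℤ, ENNReal.ofReal (4 * Real.pi ^ 2 * (∑ j, (n j : ℝ) ^ 2) / L ^ 2) *
        (‖cellFourierCoeff L φ n‖₊ : ℝ≥0∞) ^ 2 =
      (ENNReal.ofReal L ^ 3)⁻¹ * ∫⁻ x in cell L,
        ∑ j : Fin 3, (‖fderiv ℝ φ x (EuclideanSpace.single j (1 : ℝ))‖₊ : ℝ≥0∞) ^ 2 := by
  have hcont : ∀ j : Fin 3, Continuous fun x => fderiv ℝ φ x (EuclideanSpace.single j (1 : ℝ)) :=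
    fun j => (hφ.continuous_fderiv one_ne_zero).clm_apply continuous_const
  -- split the weight over the coordinates
  have hsplit : ∀ n : Fin 3 → ℤ, ENNReal.ofReal (4 * Real.pi ^ 2 * (∑ j, (n j : ℝ) ^ 2) / L ^ 2) *
      (‖cellFourierCoeff L φ n‖₊ : ℝ≥0∞) ^ 2 =
      ∑ j : Fin 3, ((‖cellFourierCoeff L (fun x => fderiv ℝ φ x (EuclideanSpace.single j 1)) n‖₊ :
        ℝ≥0∞) ^ 2) := by
    intro n
    simp only [nnnorm_sq_cellFourierCoeff_fderiv hL hφ hper]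
    rw [← Finset.sum_mul, ← ENNReal.ofReal_sum_of_nonneg (fun j _ => by positivity)]
    congr 2
    rw [Finset.mul_sum, Finset.sum_div]
  simp only [hsplit]
  rw [Summable.tsum_finsetSum (fun j _ => ENNReal.summable)]
  simp only [tsum_sq_cellFourierCoeff hL (hcont _)]
  rw [← Finset.mul_sum, lintegral_finsetSum _ (fun j _ => ?_)]
  exact ((hcont j).measurable.nnnorm.coe_nnreal_ennreal.pow_const _)

end Derivative

/-! ### Convergence of the cubic partial sums in `L²` of the cell -/

section PartialSums

variable {L : ℝ}

/-- The cubes `{-N,…,N}³ = Finset.Icc (-N) N ⊂ ℤ³` (Mathlib's order intervals of `Fin 3 → ℤ`)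
exhaust `ℤ³` monotonically. [folklore] -/
theorem tendsto_Icc_neg_atTop :
    Tendsto (fun N : ℕ => Finset.Icc (-(N : Fin 3 → ℤ)) (N : Fin 3 → ℤ)) atTop atTop := by
  refine tendsto_atTop_finset_of_monotone (fun M N hMN => ?_) (fun n => ?_)
  · intro m hm
    simp only [Finset.mem_Icc, Pi.le_def, Pi.neg_apply, Pi.natCast_apply] at hm ⊢
    have hMN' : (M : ℤ) ≤ N := (Nat.cast_le (α := ℤ)).2 hMN
    exact ⟨fun k => by linarith [hm.1 k], fun k => by linarith [hm.2 k]⟩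
  · refine ⟨(Finset.univ.sup fun k => (n k).natAbs), ?_⟩
    simp only [Finset.mem_Icc, Pi.le_def, Pi.neg_apply, Pi.natCast_apply]
    have hk : ∀ k, ((n k).natAbs : ℤ) ≤ ((Finset.univ.sup fun k => (n k).natAbs : ℕ) : ℤ) := fun k => by
      exact_mod_cast Finset.le_sup (f := fun k => (n k).natAbs) (Finset.mem_univ k)
    constructor
    · intro k
      have h1 : -((n k).natAbs : ℤ) ≤ n k := by omega
      linarith [hk k]
    · intro k
      have h2 : n k ≤ ((n k).natAbs : ℤ) := by omega
      linarith [hk k]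

/-- The cubic partial sum `S_N φ = ∑_{n ∈ {-N,…,N}³} ĉₙ(φ) e_n` of the Fourier series (the cube is
Mathlib's `Finset.Icc (-N) N` in `ℤ³`). [folklore] -/
def partialSum (L : ℝ) (φ : Space → ℂ) (N : ℕ) (x : Space) : ℂ :=
  ∑ n ∈ Finset.Icc (-(N : Fin 3 → ℤ)) (N : Fin 3 → ℤ), cellFourierCoeff L φ n * cellWave L n x

/-- `∫⁻ ‖h‖₊² = ‖h‖ₑ²` for `h ∈ L²`. [folklore] -/
theorem lintegral_nnnorm_sq_eq_enorm_sq {α : Type*} [MeasurableSpace α] {μ : Measure α}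
    (h : Lp ℂ 2 μ) : ∫⁻ t, (‖(h : α → ℂ) t‖₊ : ℝ≥0∞) ^ 2 ∂μ = ‖h‖ₑ ^ 2 := by
  rw [Lp.enorm_def, eLpNorm_eq_lintegral_rpow_enorm_toReal two_ne_zero ENNReal.ofNat_ne_top]
  simp only [ENNReal.toReal_ofNat, one_div]
  rw [← ENNReal.rpow_natCast, ← ENNReal.rpow_mul]
  norm_num
  refine lintegral_congr fun t => ?_
  rw [← ENNReal.rpow_natCast]
  norm_num
  rfl

/-- **`L²` convergence of the Fourier series on the cell**: for continuous `φ`,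
`∫_{[0,L)³} ‖S_N φ - φ‖² → 0` along the cubes (Mathlib's Hilbert-basis property of the
monomials on `(ℝ/ℤ)³`, transported). [folklore] -/
theorem tendsto_lintegral_sq_partialSum_sub (hL : 0 < L) {φ : Space → ℂ} (hφ : Continuous φ) :
    Tendsto (fun N => ∫⁻ x in cell L, (‖partialSum L φ N x - φ x‖₊ : ℝ≥0∞) ^ 2) atTop (𝓝 0) := by
  have hf := memLp_torusFun hL hφ
  set F : Lp ℂ 2 (volume : Measure (UnitAddTorus (Fin 3))) := hf.toLp _ with hFdef
  have hcoeff : ∀ n, UnitAddTorus.mFourierCoeff (F : UnitAddTorus (Fin 3) → ℂ) n =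
      cellFourierCoeff L φ n := fun n =>
    integral_congr_ae (hf.coeFn_toLp.mono fun t ht => by
      show UnitAddTorus.mFourier (-n) t • (F : UnitAddTorus (Fin 3) → ℂ) t = _
      rw [hFdef, ht])
  have hsum := UnitAddTorus.hasSum_mFourier_series_L2 F
  simp only [hcoeff] at hsum
  -- partial sums along the cubes converge in `L²((ℝ/ℤ)³)`
  have hG : Tendsto (fun N : ℕ => ∑ n ∈ Finset.Icc (-(N : Fin 3 → ℤ)) (N : Fin 3 → ℤ),
      cellFourierCoeff L φ n • UnitAddTorus.mFourierLp 2 n) atTop (𝓝 F) :=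
    hsum.comp tendsto_Icc_neg_atTop
  have hnorm : Tendsto (fun N : ℕ => ‖(∑ n ∈ Finset.Icc (-(N : Fin 3 → ℤ)) (N : Fin 3 → ℤ),
      cellFourierCoeff L φ n • UnitAddTorus.mFourierLp 2 n) - F‖ₑ ^ 2) atTop (𝓝 0) := by
    have h1 := (tendsto_iff_norm_sub_tendsto_zero.1 hG)
    have h2 : Tendsto (fun N : ℕ => ‖(∑ n ∈ Finset.Icc (-(N : Fin 3 → ℤ)) (N : Fin 3 → ℤ),
        cellFourierCoeff L φ n • UnitAddTorus.mFourierLp 2 n) - F‖ₑ) atTop (𝓝 0) := by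
      have := ENNReal.tendsto_ofReal h1
      simp only [ENNReal.ofReal_zero] at this
      refine this.congr fun N => ?_
      rw [ofReal_norm]
    have h3 := (ENNReal.continuous_pow 2).continuousAt.tendsto.comp h2
    simpa [Function.comp_def] using h3
  -- identify the `L²` distance with the cell integral
  have hid : ∀ N : ℕ, ‖(∑ n ∈ Finset.Icc (-(N : Fin 3 → ℤ)) (N : Fin 3 → ℤ),
      cellFourierCoeff L φ n • UnitAddTorus.mFourierLp 2 n) - F‖ₑ ^ 2 =
      (ENNReal.ofReal L ^ 3)⁻¹ * ∫⁻ x in cell L, (‖partialSum L φ N x - φ x‖₊ : ℝ≥0∞) ^ 2 := by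
    intro N
    rw [← lintegral_nnnorm_sq_eq_enorm_sq]
    have hmeas : Measurable fun x : Space => (‖partialSum L φ N x - φ x‖₊ : ℝ≥0∞) ^ 2 := by
      refine (Measurable.nnnorm ?_).coe_nnreal_ennreal.pow_const _
      refine (Finset.measurable_sum _ fun n _ => ?_).sub hφ.measurable
      exact ((contDiff_cellWave L n).continuous.measurable).const_mul _
    rw [← lintegral_fromUnitTorus hL hmeas]
    refine lintegral_congr_ae ?_
    have hae : ∀ n ∈ Finset.Icc (-(N : Fin 3 → ℤ)) (N : Fin 3 → ℤ),
        (fun t => ((cellFourierCoeff L φ n • UnitAddTorus.mFourierLp 2 n :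
        Lp ℂ 2 (volume : Measure (UnitAddTorus (Fin 3)))) : UnitAddTorus (Fin 3) → ℂ) t) =ᵐ[volume]
        fun t => cellFourierCoeff L φ n * UnitAddTorus.mFourier n t := by
      intro n _
      filter_upwards [Lp.coeFn_smul (cellFourierCoeff L φ n) (UnitAddTorus.mFourierLp
        (d := Fin 3) 2 n), UnitAddTorus.coeFn_mFourierLp (d := Fin 3) 2 n] with t h1 h2
      rw [h1, Pi.smul_apply, h2, smul_eq_mul]
    filter_upwards [Lp.coeFn_sub (∑ n ∈ Finset.Icc (-(N : Fin 3 → ℤ)) (N : Fin 3 → ℤ),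
        cellFourierCoeff L φ n • UnitAddTorus.mFourierLp 2 n) F,
      Lp.coeFn_finsetSum (Finset.Icc (-(N : Fin 3 → ℤ)) (N : Fin 3 → ℤ))
        (fun n => cellFourierCoeff L φ n • UnitAddTorus.mFourierLp (d := Fin 3) 2 n), hf.coeFn_toLp,
      (ae_ball_iff (Finset.Icc (-(N : Fin 3 → ℤ)) (N : Fin 3 → ℤ)).countable_toSet).2 hae]
      with t h1 h2 h3 h4
    rw [h1, Pi.sub_apply, h2, Finset.sum_apply, h3]
    simp only [partialSum, torusFun, cellWave, toUnitTorus_fromUnitTorus hL.ne']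
    rw [Finset.sum_congr rfl fun n hn => h4 n hn]
  simp only [hid] at hnorm
  have hL3 : (ENNReal.ofReal L ^ 3) ≠ 0 := pow_ne_zero _ (by simpa using hL)
  have hL3' : (ENNReal.ofReal L ^ 3) ≠ ⊤ := ENNReal.pow_ne_top ENNReal.ofReal_ne_top
  have := ENNReal.Tendsto.const_mul hnorm (Or.inr hL3')  (a := ENNReal.ofReal L ^ 3)
  simp only [mul_zero] at this
  refine this.congr fun N => ?_
  rw [← mul_assoc, ENNReal.mul_inv_cancel hL3 hL3', one_mul]

/-- The partial sums are smooth. [folklore] -/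
theorem contDiff_partialSum (L : ℝ) (φ : Space → ℂ) (N : ℕ) :
    ContDiff ℝ (⊤ : ℕ∞) (partialSum L φ N) := by
  unfold partialSum
  exact ContDiff.sum fun n _ => contDiff_const.mul (contDiff_cellWave L n)

/-- The partial sums are `Lℤ³`-periodic. [folklore] -/
theorem partialSum_periodic {L : ℝ} (hL : L ≠ 0) (φ : Space → ℂ) (N : ℕ) (x : Space) (k : Fin 3) :
    partialSum L φ N (x + EuclideanSpace.single k L) = partialSum L φ N x := by
  unfold partialSum
  simp only [cellWave_periodic hL]

/-- **Derivatives commute with partial sums**: `∂ⱼ(S_N φ) = S_N(∂ⱼφ)` for `C¹` periodic `φ`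
(the derivative rule `ĉₙ(∂ⱼφ) = (2πi nⱼ/L) ĉₙ(φ)` and `∂ⱼ e_n = (2πi nⱼ/L) e_n`). [folklore] -/
theorem fderiv_partialSum {L : ℝ} (hL : 0 < L) {φ : Space → ℂ} (hφ : ContDiff ℝ 1 φ)
    (hper : ∀ (x : Space) (k : Fin 3), φ (x + EuclideanSpace.single k L) = φ x) (N : ℕ) (j : Fin 3)
    (x : Space) :
    fderiv ℝ (partialSum L φ N) x (EuclideanSpace.single j 1) =
      partialSum L (fun y => fderiv ℝ φ y (EuclideanSpace.single j 1)) N x := by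
  have hdiff : ∀ n : Fin 3 → ℤ, DifferentiableAt ℝ (fun y => cellFourierCoeff L φ n * cellWave L n y) x :=
    fun n => (((contDiff_cellWave L n).differentiable (by simp)) x).const_mul _
  have hfun : partialSum L φ N = fun y => ∑ n ∈ Finset.Icc (-(N : Fin 3 → ℤ)) (N : Fin 3 → ℤ),
      cellFourierCoeff L φ n * cellWave L n y := by
    funext y; rfl
  rw [hfun, fderiv_fun_sum fun n _ => hdiff n, FunLike.coe_sum, Finset.sum_apply]
  unfold partialSum
  refine Finset.sum_congr rfl fun n _ => ?_
  rw [fderiv_const_mul (((contDiff_cellWave L n).differentiable (by simp)) x), smul_apply,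
    fderiv_cellWave_apply_single, cellFourierCoeff_fderiv hL hφ hper, smul_eq_mul]
  ring

end PartialSums


end Literature.MathematicalPhysics.QuantumManyBody.BoseGas
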